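import Literature.MathematicalPhysics.QuantumLattice.MagneticHubbardTorusPeierls
import Literature.MathematicalPhysics.QuantumLattice.FinDimSpectrumSectorGibbsLimit
import Literature.MathematicalPhysics.QuantumLattice.FermionHopAmplitudeBound
import HarnessLib

/-!
# Bloch's bound in a background orbital field: the cost of a handle twist on top of ANY lattice
# `U(1)` gauge field is at most `2θ²` (symmetrised), hence every flux stiffness is `≤ 2`

Topic `Literature/MathematicalPhysics/QuantumLattice` (family `hubbard`). Companion of
`MagneticHubbardTorus(Peierls).lean` (the Hubbard torus `magneticHubbardTorus L A t U` in an arbitrary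
lattice `U(1)` gauge field `A`, and the Peierls unfolding `re_star_dotProduct_magneticHubbardTorus_mulVec`)
and of `HubbardTorusFluxBlochBound.lean` (the ZERO-field statement `E^T_L(θ) ≤ E^T_L(0) + 2θ²`).
Requested by the Hubbard cuprate cell `pub/hubbard-tc` (MO-S3, KT back-end): the `H`-axis of the
D-0099 phase map needs a flux-stiffness ceiling that survives an ORBITAL magnetic field (lead ruling
R27: the kinematic rows of record are reached by rotation averaging, which a Landau gauge breaks).

## The object and the statement

For a gauge field `A : GaugeConfig 2 L Circle` on the `L × L` torus, thread an ADDITIONAL Aharonov–Bohm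
flux `θ` through the `e₁`-handle on top of `A`, spread uniformly (`A · uniformTwistConfig L θ`: every
`e₁`-edge phase is multiplied by `e^{iθ/L}`), and let
`E_A(θ) := magneticTwistEnergy L A U δ θ` be the ground-state energy of `magneticHubbardTorus L (A·τ_θ) 1 U`
in the sector `(N_L, S^z = 0)`, `N_L = 2⌊(1−δ)L²/2⌋` (the convention of `fluxEnergy`).
PROVED here, for EVERY `L ≥ 1`, `A`, `U`, `δ`, `θ`:

* `re_rayleigh_twist_add_twist_neg` — pricing a vector `φ` in the two twisted Hamiltonians,
  `Re⟨φ,H_{A·τ_θ}φ⟩ + Re⟨φ,H_{A·τ_{−θ}}φ⟩ = 2 Re⟨φ,H_Aφ⟩ + 4(1 − cos(θ/L))·Σ_{x,σ} Re(A(x,e₁)·h_{x,σ}(φ))`,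
  `h_{x,σ}(φ) = ⟨φ, c†_{x+e₁,σ}c_{x,σ}φ⟩` (the current terms `± sin` cancel between `+θ` and `−θ`; with a
  background field `E_A(−θ) ≠ E_A(θ)` in general, so the symmetrisation replaces the time-reversal step of
  the zero-field proof);
* `magneticTwistEnergy_add_neg_le` — **`E_A(θ) + E_A(−θ) ≤ 2·E_A(0) + 4θ²`** (each `|h| ≤ 1`, `2L²` terms,
  `1 − cos(θ/L) ≤ θ²/(2L²)`; inf over `φ`);
* `magneticFluxStiffness_le_two` — consequently every flux-stiffness constant of `H_A` is at most `2`: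
  if `ρ θ² ≤ E_A(θ) − E_A(0)` for `|θ| ≤ θ₀` (some `θ₀ > 0`) then `ρ ≤ 2` — uniformly in the field `A`,
  the coupling `U`, the filling and `L`.

With the Nelson–Kosterlitz reading of the cell (`k_BT_KT ≤ (π/2)·J`, `J = ρ/2` — a hypothesis of the
cell's dictionary, NOT a theorem here) this is the orbital-field-robust, utterly non-sharp ceiling
`k_B T_KT ≤ (π/2)·t` per plane; the zero-field kinematic rows (`4/π² + O(1/L)` at half filling) are
sharper but are NOT licensed in an orbital field. No thermodynamic limit is taken (every `L` is covered).

HONEST SCOPE: an elementary variational inequality on a finite torus (Bloch 1949 / Bohm's argument in a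
background field); no number of physical interest, nothing about superconductivity, no claim that a
Kosterlitz–Thouless transition exists.

## References
* D. Bohm, Phys. Rev. 75 (1949) 502 (Bloch's theorem on persistent currents). [Bohm1949]
* H. Watanabe, J. Stat. Phys. 177 (2019) 717, §2.2.1 eqs. (13)–(16), §4.1 (twist operator, `O(1)` cost
  in `d = 2`). [Watanabe2019]
* E. H. Lieb, PRL 73 (1994) 2158, eqs. (1)–(2) (Peierls phases). [Lieb1994]
* D. J. Scalapino, S. R. White, S. Zhang, PRB 47 (1993) 7995, §II (flux stiffness / f-sum). [ScalapinoWhiteZhang1993]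
-/

noncomputable section

namespace Literature.MathematicalPhysics.QuantumLattice

open Matrix Finset Literature.MathematicalPhysics.QuantumFieldTheory
open scoped ComplexConjugate

variable (L : ℕ) [NeZero L]

/-- **The handle-twisted sector energy in a background field**: `E_A(θ)` = the minimum of `Re⟨ψ, H ψ⟩`
over unit vectors of the sector `(N_L, S^z = 0)`, `N_L = 2⌊(1−δ)L²/2⌋`, for
`H = magneticHubbardTorus L (A · uniformTwistConfig L θ) 1 U` — the Peierls field `A` with every `e₁`-edge
phase multiplied by `e^{iθ/L}` (an extra flux `θ` through the `e₁`-handle). At `A = 1`, `L ≥ 3` this is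
the tree's `fluxEnergy L U δ θ` (`fluxEnergy_eq_minEnergyOn_uniformTwistConfig`).
Watanabe, J. Stat. Phys. 177 (2019) 717, §2.2.1. [cite: Watanabe2019, §2.2.1] -/
def magneticTwistEnergy (A : GaugeConfig 2 L Circle) (U δ θ : ℝ) : ℝ :=
  (magneticHubbardTorus L (A * uniformTwistConfig L θ) 1 U).minEnergyOn
    (szSector (Λ := FermionTorus 2 L) (2 * ⌊(1 - δ) * (L : ℝ) ^ 2 / 2⌋₊) 0)

variable {L}

omit [NeZero L] in
/-- Zero extra flux: `uniformTwistConfig L 0 = 1` (Watanabe's `U_0 = 1`). [cite: Watanabe2019, §2.2.1] -/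
theorem uniformTwistConfig_zero : uniformTwistConfig L 0 = 1 := by
  funext e
  obtain ⟨x, i⟩ := e
  rw [uniformTwistConfig_apply]
  split_ifs with h
  · rw [zero_div, Circle.exp_zero]; rfl
  · rfl

/-- `E_A(0)` is the sector ground-state energy of `H_A` itself (no extra twist). [cite: Watanabe2019, §2.2.1] -/
theorem magneticTwistEnergy_zero (A : GaugeConfig 2 L Circle) (U δ : ℝ) :
    magneticTwistEnergy L A U δ 0 = (magneticHubbardTorus L A 1 U).minEnergyOn
      (szSector (Λ := FermionTorus 2 L) (2 * ⌊(1 - δ) * (L : ℝ) ^ 2 / 2⌋₊) 0) := by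
  rw [magneticTwistEnergy, uniformTwistConfig_zero, mul_one]

omit [NeZero L] in
/-- The twisted field on an edge: `(A·τ_θ)(x,e₁) = A(x,e₁)·e^{iθ/L}` and `(A·τ_θ)(x,e₂) = A(x,e₂)`, as
complex numbers. [folklore] -/
private theorem coe_mul_uniformTwistConfig_apply (A : GaugeConfig 2 L Circle) (θ : ℝ) (x : Site 2 L) (i : Fin 2) :
    (((A * uniformTwistConfig L θ) (x, i) : Circle) : ℂ) =
      ((A (x, i) : Circle) : ℂ) * (if i = 0 then Complex.exp (((θ / L : ℝ) : ℂ) * Complex.I) else 1) := by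
  rw [Pi.mul_apply, Circle.coe_mul, uniformTwistConfig_apply]
  split_ifs with h
  · rw [Circle.coe_exp]
  · rw [Circle.coe_one]

/-- The scalar bookkeeping behind the symmetrised twist: for `a, h ∈ ℂ` and `u ∈ ℝ`, with `b_± = a·e^{±iu}`,
`[2(1 − Re b₊)Re h + 2 Im b₊ Im h] + [2(1 − Re b₋)Re h + 2 Im b₋ Im h] − 2[2(1 − Re a)Re h + 2 Im a Im h]
 = 4(1 − cos u)·Re(a h)`. [folklore] -/
private theorem peierls_twist_scalar (a h : ℂ) (u : ℝ) :
    (2 * (1 - (a * Complex.exp (((u : ℝ) : ℂ) * Complex.I)).re) * h.re +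
        2 * (a * Complex.exp (((u : ℝ) : ℂ) * Complex.I)).im * h.im) +
      (2 * (1 - (a * Complex.exp (((-u : ℝ) : ℂ) * Complex.I)).re) * h.re +
        2 * (a * Complex.exp (((-u : ℝ) : ℂ) * Complex.I)).im * h.im) -
      2 * (2 * (1 - a.re) * h.re + 2 * a.im * h.im) =
      4 * (1 - Real.cos u) * (a * h).re := by
  simp only [Complex.mul_re, Complex.mul_im, Complex.exp_ofReal_mul_I_re, Complex.exp_ofReal_mul_I_im,
    Real.cos_neg, Real.sin_neg]
  ring

/-- **Pricing one vector in the two twisted Hamiltonians** (`t = 1`): for every `φ`,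
`Re⟨φ,H_{A·τ_θ}φ⟩ + Re⟨φ,H_{A·τ_{−θ}}φ⟩ = 2 Re⟨φ,H_Aφ⟩ + 4(1 − cos(θ/L)) Σ_{x,σ} Re(A(x,e₁)·h_{x,σ}(φ))`,
`h_{x,σ}(φ) = ⟨φ, c†_{x+e₁,σ}c_{x,σ}φ⟩`: the two current terms cancel, only the kinetic weights along the
field survive. Watanabe (2019) §2.2.1 eqs. (13)–(16) (at `A = 1`). [cite: Watanabe2019, §2.2.3 and §4.1] -/
theorem re_rayleigh_twist_add_twist_neg (A : GaugeConfig 2 L Circle) (U θ : ℝ)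
    (φ : Fock (Orb (FermionTorus 2 L))) :
    (star φ ⬝ᵥ (magneticHubbardTorus L (A * uniformTwistConfig L θ) 1 U *ᵥ φ)).re +
        (star φ ⬝ᵥ (magneticHubbardTorus L (A * uniformTwistConfig L (-θ)) 1 U *ᵥ φ)).re =
      2 * (star φ ⬝ᵥ (magneticHubbardTorus L A 1 U *ᵥ φ)).re +
        4 * (1 - Real.cos (θ / L)) *
          ∑ x : Site 2 L, ∑ σ : Fin 2,
            (((A (x, 0) : Circle) : ℂ) *
              (star φ ⬝ᵥ ((creation (orb (FermionTorus.ofTorusSite (Site.shift x 0)) σ) *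
                annihilation (orb (FermionTorus.ofTorusSite x) σ)) *ᵥ φ))).re := by
  rw [re_star_dotProduct_magneticHubbardTorus_mulVec (A * uniformTwistConfig L θ),
    re_star_dotProduct_magneticHubbardTorus_mulVec (A * uniformTwistConfig L (-θ)),
    re_star_dotProduct_magneticHubbardTorus_mulVec A]
  -- reduce to a per-site identity
  have key : ∀ x : Site 2 L,
      (∑ i : Fin 2, ∑ σ : Fin 2,
          (2 * (1 - (((A * uniformTwistConfig L θ) (x, i) : Circle) : ℂ).re) *
              (star φ ⬝ᵥ ((creation (orb (FermionTorus.ofTorusSite (Site.shift x i)) σ) *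
                annihilation (orb (FermionTorus.ofTorusSite x) σ)) *ᵥ φ)).re +
            2 * (((A * uniformTwistConfig L θ) (x, i) : Circle) : ℂ).im *
              (star φ ⬝ᵥ ((creation (orb (FermionTorus.ofTorusSite (Site.shift x i)) σ) *
                annihilation (orb (FermionTorus.ofTorusSite x) σ)) *ᵥ φ)).im)) +
        (∑ i : Fin 2, ∑ σ : Fin 2,
          (2 * (1 - (((A * uniformTwistConfig L (-θ)) (x, i) : Circle) : ℂ).re) *
              (star φ ⬝ᵥ ((creation (orb (FermionTorus.ofTorusSite (Site.shift x i)) σ) *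
                annihilation (orb (FermionTorus.ofTorusSite x) σ)) *ᵥ φ)).re +
            2 * (((A * uniformTwistConfig L (-θ)) (x, i) : Circle) : ℂ).im *
              (star φ ⬝ᵥ ((creation (orb (FermionTorus.ofTorusSite (Site.shift x i)) σ) *
                annihilation (orb (FermionTorus.ofTorusSite x) σ)) *ᵥ φ)).im)) -
        2 * (∑ i : Fin 2, ∑ σ : Fin 2,
          (2 * (1 - ((A (x, i) : Circle) : ℂ).re) *
              (star φ ⬝ᵥ ((creation (orb (FermionTorus.ofTorusSite (Site.shift x i)) σ) *
                annihilation (orb (FermionTorus.ofTorusSite x) σ)) *ᵥ φ)).re +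
            2 * ((A (x, i) : Circle) : ℂ).im *
              (star φ ⬝ᵥ ((creation (orb (FermionTorus.ofTorusSite (Site.shift x i)) σ) *
                annihilation (orb (FermionTorus.ofTorusSite x) σ)) *ᵥ φ)).im)) =
        4 * (1 - Real.cos (θ / L)) * ∑ σ : Fin 2,
          (((A (x, 0) : Circle) : ℂ) *
            (star φ ⬝ᵥ ((creation (orb (FermionTorus.ofTorusSite (Site.shift x 0)) σ) *
              annihilation (orb (FermionTorus.ofTorusSite x) σ)) *ᵥ φ))).re := by
    intro x
    simp only [coe_mul_uniformTwistConfig_apply, Fin.sum_univ_two, Fin.isValue, if_true,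
      show ((1 : Fin 2) = 0) = False from by decide, if_false, mul_one]
    have h0 := peierls_twist_scalar ((A (x, 0) : Circle) : ℂ)
      (star φ ⬝ᵥ ((creation (orb (FermionTorus.ofTorusSite (Site.shift x 0)) 0) *
        annihilation (orb (FermionTorus.ofTorusSite x) 0)) *ᵥ φ)) (θ / L)
    have h1 := peierls_twist_scalar ((A (x, 0) : Circle) : ℂ)
      (star φ ⬝ᵥ ((creation (orb (FermionTorus.ofTorusSite (Site.shift x 0)) 1) *
        annihilation (orb (FermionTorus.ofTorusSite x) 1)) *ᵥ φ)) (θ / L)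
    rw [show ((-θ : ℝ) / L : ℝ) = -(θ / L) by ring]
    rw [show ((-(θ / (L : ℝ)) : ℝ) : ℂ) = (((-(θ / L) : ℝ)) : ℂ) from rfl] at *
    linear_combination h0 + h1
  -- sum the per-site identity over `x`
  have hsum := Finset.sum_congr rfl fun (x : Site 2 L) (_ : x ∈ Finset.univ) => key x
  rw [Finset.sum_sub_distrib, Finset.sum_add_distrib, ← Finset.mul_sum, ← Finset.mul_sum] at hsum
  linarith [hsum]

/-- Each field-weighted hopping amplitude has real part of modulus `≤ 1` in a unit vector (`|A(x,e₁)| = 1`,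
`‖c†‖, ‖c‖ ≤ 1`). [folklore] -/
private theorem abs_re_coe_mul_hop_le {φ : Fock (Orb (FermionTorus 2 L))} (hφ : star φ ⬝ᵥ φ = 1)
    (a : Circle) (x : Site 2 L) (σ : Fin 2) :
    |((a : ℂ) * (star φ ⬝ᵥ ((creation (orb (FermionTorus.ofTorusSite (Site.shift x 0)) σ) *
        annihilation (orb (FermionTorus.ofTorusSite x) σ)) *ᵥ φ))).re| ≤ 1 := by
  refine (Complex.abs_re_le_norm _).trans ?_
  rw [norm_mul, Circle.norm_coe, one_mul]
  exact norm_star_dotProduct_creation_mul_annihilation_mulVec_le hφ _ _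

/-- The field-weighted `e₁`-kinetic weight of a unit vector is at most `2L²` in modulus (`2L²` terms of modulus
`≤ 1`) — the `O(L^{d})`-bond count behind the `O(L^{d−2})` twist cost. [cite: Watanabe2019, §4.1] -/
theorem abs_sum_re_coe_mul_hop_le {φ : Fock (Orb (FermionTorus 2 L))} (hφ : star φ ⬝ᵥ φ = 1)
    (A : GaugeConfig 2 L Circle) :
    |∑ x : Site 2 L, ∑ σ : Fin 2,
        (((A (x, 0) : Circle) : ℂ) *
          (star φ ⬝ᵥ ((creation (orb (FermionTorus.ofTorusSite (Site.shift x 0)) σ) *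
            annihilation (orb (FermionTorus.ofTorusSite x) σ)) *ᵥ φ))).re| ≤ 2 * (L : ℝ) ^ 2 := by
  refine (Finset.abs_sum_le_sum_abs _ _).trans ?_
  have h : ∀ x ∈ (Finset.univ : Finset (Site 2 L)), |∑ σ : Fin 2,
      (((A (x, 0) : Circle) : ℂ) *
        (star φ ⬝ᵥ ((creation (orb (FermionTorus.ofTorusSite (Site.shift x 0)) σ) *
          annihilation (orb (FermionTorus.ofTorusSite x) σ)) *ᵥ φ))).re| ≤ 2 := fun x _ => by
    refine (Finset.abs_sum_le_sum_abs _ _).trans ?_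
    refine (Finset.sum_le_sum fun σ _ => abs_re_coe_mul_hop_le hφ (A (x, 0)) x σ).trans ?_
    simp
  refine (Finset.sum_le_sum h).trans ?_
  rw [Finset.sum_const, Finset.card_univ, nsmul_eq_mul]
  have hcard : (Fintype.card (Site 2 L) : ℝ) = (L : ℝ) ^ 2 := by
    rw [Fintype.card_fun, ZMod.card, Fintype.card_fin]; push_cast; ring
  rw [hcard]
  ring_nf
  rfl

/-- **From a symmetrised variational bound to the twisted sector energies**: if every unit vector `ψ` of
the sector prices the pair of twists at `2 Re⟨ψ,H_Aψ⟩ + c` (`c ≥ 0`), then `E_A(θ) + E_A(−θ) ≤ 2E_A(0) + c`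
(take `inf` over `ψ`; on an empty sector all three energies are the junk value `sInf ∅ = 0`): the variational
principle behind the twist bound. [cite: Watanabe2019, §2.2.3 and §4.1] -/
theorem magneticTwistEnergy_add_neg_le_of_rayleigh (A : GaugeConfig 2 L Circle) (U δ θ : ℝ) {c : ℝ}
    (hc : 0 ≤ c)
    (hvar : ∀ ψ ∈ szSector (Λ := FermionTorus 2 L) (2 * ⌊(1 - δ) * (L : ℝ) ^ 2 / 2⌋₊) 0,
      star ψ ⬝ᵥ ψ = 1 →
        magneticTwistEnergy L A U δ θ + magneticTwistEnergy L A U δ (-θ) ≤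
          2 * (star ψ ⬝ᵥ (magneticHubbardTorus L A 1 U *ᵥ ψ)).re + c) :
    magneticTwistEnergy L A U δ θ + magneticTwistEnergy L A U δ (-θ) ≤
      2 * magneticTwistEnergy L A U δ 0 + c := by
  rw [magneticTwistEnergy_zero]
  unfold magneticTwistEnergy
  set K := szSector (Λ := FermionTorus 2 L) (2 * ⌊(1 - δ) * (L : ℝ) ^ 2 / 2⌋₊) 0 with hK
  by_cases hne : ∃ ψ ∈ K, star ψ ⬝ᵥ ψ = (1 : ℂ)
  · obtain ⟨ψ₀, hψ₀, h₀⟩ := hne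
    have hS : {E : ℝ | ∃ ψ ∈ K, star ψ ⬝ᵥ ψ = 1 ∧
        E = (star ψ ⬝ᵥ (magneticHubbardTorus L A 1 U *ᵥ ψ)).re}.Nonempty := ⟨_, ψ₀, hψ₀, h₀, rfl⟩
    have h0 : (magneticHubbardTorus L A 1 U).minEnergyOn K = sInf {E : ℝ | ∃ ψ ∈ K, star ψ ⬝ᵥ ψ = 1 ∧
        E = (star ψ ⬝ᵥ (magneticHubbardTorus L A 1 U *ᵥ ψ)).re} := rfl
    refine le_of_forall_pos_lt_add fun ε hε => ?_
    obtain ⟨E, ⟨ψ, hψ, h1, rfl⟩, hE⟩ :=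
      exists_lt_of_csInf_lt hS (lt_add_of_pos_right (sInf {E : ℝ | ∃ ψ ∈ K, star ψ ⬝ᵥ ψ = 1 ∧
        E = (star ψ ⬝ᵥ (magneticHubbardTorus L A 1 U *ᵥ ψ)).re}) (half_pos hε))
    have h := hvar ψ hψ h1
    unfold magneticTwistEnergy at h
    rw [h0]
    linarith
  · have hempty : ∀ B : Matrix (Finset (Orb (FermionTorus 2 L))) (Finset (Orb (FermionTorus 2 L))) ℂ,
        B.minEnergyOn K = 0 := fun B => by
      unfold Matrix.minEnergyOn
      convert Real.sInf_empty
      ext E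
      simp only [Set.mem_setOf_eq, Set.mem_empty_iff_false, iff_false, not_exists, not_and]
      exact fun ψ hψ h1 _ => hne ⟨ψ, hψ, h1⟩
    rw [hempty, hempty, hempty]
    linarith

/-- **Bloch's bound in a background field**: for every `L ≥ 1`, every gauge field `A`, every `U, δ, θ`,
`E_A(θ) + E_A(−θ) ≤ 2·E_A(0) + 4θ²` — threading a flux `±θ` through a handle of the torus on top of any
orbital field costs `O(1)` in `d = 2`, uniformly in the field. Bohm 1949 (Bloch's argument); Watanabe 2019
§4.1 at zero field. [cite: Bohm1949] [cite: Watanabe2019, §2.2.3 and §4.1] -/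
theorem magneticTwistEnergy_add_neg_le (A : GaugeConfig 2 L Circle) (U δ θ : ℝ) :
    magneticTwistEnergy L A U δ θ + magneticTwistEnergy L A U δ (-θ) ≤
      2 * magneticTwistEnergy L A U δ 0 + 4 * θ ^ 2 := by
  refine magneticTwistEnergy_add_neg_le_of_rayleigh A U δ θ (by positivity) fun ψ hψ h1 => ?_
  have hL0 : (0 : ℝ) < L := Nat.cast_pos.2 (NeZero.pos L)
  set K : ℝ := ∑ x : Site 2 L, ∑ σ : Fin 2,
    (((A (x, 0) : Circle) : ℂ) *
      (star ψ ⬝ᵥ ((creation (orb (FermionTorus.ofTorusSite (Site.shift x 0)) σ) *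
        annihilation (orb (FermionTorus.ofTorusSite x) σ)) *ᵥ ψ))).re with hKdef
  have hKle : |K| ≤ 2 * (L : ℝ) ^ 2 := abs_sum_re_coe_mul_hop_le h1 A
  have hp : magneticTwistEnergy L A U δ θ ≤
      (star ψ ⬝ᵥ (magneticHubbardTorus L (A * uniformTwistConfig L θ) 1 U *ᵥ ψ)).re :=
    minEnergyOn_le_rayleigh_of_mem (magneticHubbardTorus_isHermitian _ 1 U) _ hψ h1
  have hm : magneticTwistEnergy L A U δ (-θ) ≤
      (star ψ ⬝ᵥ (magneticHubbardTorus L (A * uniformTwistConfig L (-θ)) 1 U *ᵥ ψ)).re :=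
    minEnergyOn_le_rayleigh_of_mem (magneticHubbardTorus_isHermitian _ 1 U) _ hψ h1
  have hid := re_rayleigh_twist_add_twist_neg A U θ ψ
  have hc : 0 ≤ 1 - Real.cos (θ / L) := sub_nonneg.2 (Real.cos_le_one _)
  have hcos : 2 * (1 - Real.cos (θ / L)) ≤ (θ / L) ^ 2 := by
    have h := Real.one_sub_sq_div_two_le_cos (x := θ / L)
    nlinarith
  have hstep : 4 * (1 - Real.cos (θ / L)) * K ≤ 4 * θ ^ 2 :=
    calc 4 * (1 - Real.cos (θ / L)) * K ≤ 4 * (1 - Real.cos (θ / L)) * |K| := by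
          have := le_abs_self K; nlinarith
      _ = 2 * (2 * (1 - Real.cos (θ / L))) * |K| := by ring
      _ ≤ 2 * (θ / L) ^ 2 * |K| := by gcongr
      _ ≤ 2 * (θ / L) ^ 2 * (2 * (L : ℝ) ^ 2) := by gcongr
      _ = 4 * θ ^ 2 := by field_simp; ring
  linarith

/-- **Every flux stiffness of the Hubbard torus in an orbital field is at most `2`** (tree units, `t = 1`):
if `ρ > 0` and `ρ θ² ≤ E_A(θ) − E_A(0)` for all `|θ| ≤ θ₀` (some `θ₀ > 0`) then `ρ ≤ 2` — for every `L`, every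
lattice `U(1)` gauge field `A`, every `U` and filling. (The zero-field rotation-averaged kinematic rows are
sharper, `ρ ≤ 4/π² + O(1/L)` at half filling, but do not survive an orbital field.) [cite: Bohm1949]
[cite: ScalapinoWhiteZhang1993, §II] -/
theorem magneticFluxStiffness_le_two (A : GaugeConfig 2 L Circle) (U δ ρ θ₀ : ℝ) (hθ₀ : 0 < θ₀)
    (hst : ∀ θ : ℝ, |θ| ≤ θ₀ →
      ρ * θ ^ 2 ≤ magneticTwistEnergy L A U δ θ - magneticTwistEnergy L A U δ 0) :
    ρ ≤ 2 := by
  have hp := hst θ₀ (by rw [abs_of_pos hθ₀])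
  have hm := hst (-θ₀) (by rw [abs_neg, abs_of_pos hθ₀])
  have hb := magneticTwistEnergy_add_neg_le A U δ θ₀
  have hsq : 0 < θ₀ ^ 2 := by positivity
  rw [neg_sq] at hm
  nlinarith

/-! ### `L ≥ 2`: the sharp hopping bound `|h| ≤ 1/2` halves the constant -/

/-- For `L ≥ 2` the two ends of an `e₁`-bond are distinct orbitals. [folklore] -/
private theorem orb_shift_zero_ne (hL : 2 ≤ L) (x : Site 2 L) (σ : Fin 2) :
    orb (FermionTorus.ofTorusSite (Site.shift x 0)) σ ≠ orb (FermionTorus.ofTorusSite x) σ := by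
  intro h
  have h' : FermionTorus.ofTorusSite (Site.shift x 0) = FermionTorus.ofTorusSite x :=
    congrArg (fun o : Orb (FermionTorus 2 L) => (ofLex o).1) h
  have h'' := congrArg FermionTorus.toTorusSite h'
  rw [FermionTorus.toTorusSite_ofTorusSite, FermionTorus.toTorusSite_ofTorusSite] at h''
  have h0 : x 0 + 1 = x 0 := by
    have := congrFun h'' 0
    simpa [Site.shift, Pi.add_apply, Pi.single_eq_same] using this
  have h1 : (1 : ZMod L) = 0 := by simpa using h0
  haveI : Fact (1 < L) := ⟨hL⟩
  exact one_ne_zero h1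

/-- For `L ≥ 2` each field-weighted `e₁`-hopping amplitude has real part of modulus `≤ 1/2` in a unit vector
(`|⟨φ, c†_p c_q φ⟩| ≤ 1/2` for distinct orbitals, `FermionHopAmplitudeBound`). [folklore] -/
private theorem abs_re_coe_mul_hop_le_half (hL : 2 ≤ L) {φ : Fock (Orb (FermionTorus 2 L))} (hφ : star φ ⬝ᵥ φ = 1)
    (a : Circle) (x : Site 2 L) (σ : Fin 2) :
    |((a : ℂ) * (star φ ⬝ᵥ ((creation (orb (FermionTorus.ofTorusSite (Site.shift x 0)) σ) *
        annihilation (orb (FermionTorus.ofTorusSite x) σ)) *ᵥ φ))).re| ≤ 1 / 2 := by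
  refine (Complex.abs_re_le_norm _).trans ?_
  rw [norm_mul, Circle.norm_coe, one_mul]
  exact norm_star_dotProduct_creation_mul_annihilation_mulVec_le_half hφ (orb_shift_zero_ne hL x σ)

/-- For `L ≥ 2` the field-weighted `e₁`-kinetic weight of a unit vector is at most `L²` in modulus (each bond
amplitude `≤ 1/2`: the one-body hopping between two modes has spectrum `{−1, 0, 1}`). [cite: Watanabe2019, §4.1] -/
theorem abs_sum_re_coe_mul_hop_le_sq (hL : 2 ≤ L) {φ : Fock (Orb (FermionTorus 2 L))} (hφ : star φ ⬝ᵥ φ = 1)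
    (A : GaugeConfig 2 L Circle) :
    |∑ x : Site 2 L, ∑ σ : Fin 2,
        (((A (x, 0) : Circle) : ℂ) *
          (star φ ⬝ᵥ ((creation (orb (FermionTorus.ofTorusSite (Site.shift x 0)) σ) *
            annihilation (orb (FermionTorus.ofTorusSite x) σ)) *ᵥ φ))).re| ≤ (L : ℝ) ^ 2 := by
  refine (Finset.abs_sum_le_sum_abs _ _).trans ?_
  have h : ∀ x ∈ (Finset.univ : Finset (Site 2 L)), |∑ σ : Fin 2,
      (((A (x, 0) : Circle) : ℂ) *
        (star φ ⬝ᵥ ((creation (orb (FermionTorus.ofTorusSite (Site.shift x 0)) σ) *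
          annihilation (orb (FermionTorus.ofTorusSite x) σ)) *ᵥ φ))).re| ≤ 1 := fun x _ => by
    refine (Finset.abs_sum_le_sum_abs _ _).trans ?_
    refine (Finset.sum_le_sum fun σ _ => abs_re_coe_mul_hop_le_half hL hφ (A (x, 0)) x σ).trans ?_
    norm_num
  refine (Finset.sum_le_sum h).trans ?_
  rw [Finset.sum_const, Finset.card_univ, nsmul_eq_mul]
  have hcard : (Fintype.card (Site 2 L) : ℝ) = (L : ℝ) ^ 2 := by
    rw [Fintype.card_fun, ZMod.card, Fintype.card_fin]; push_cast; ring
  rw [hcard]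
  ring_nf
  rfl

/-- **Bloch's bound in a background field, sharp constant** (`L ≥ 2`): `E_A(θ) + E_A(−θ) ≤ 2·E_A(0) + 2θ²`.
[cite: Bohm1949] [cite: Watanabe2019, §2.2.3 and §4.1] -/
theorem magneticTwistEnergy_add_neg_le_of_two_le (hL : 2 ≤ L) (A : GaugeConfig 2 L Circle) (U δ θ : ℝ) :
    magneticTwistEnergy L A U δ θ + magneticTwistEnergy L A U δ (-θ) ≤
      2 * magneticTwistEnergy L A U δ 0 + 2 * θ ^ 2 := by
  refine magneticTwistEnergy_add_neg_le_of_rayleigh A U δ θ (by positivity) fun ψ hψ h1 => ?_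
  have hL0 : (0 : ℝ) < L := Nat.cast_pos.2 (NeZero.pos L)
  set K : ℝ := ∑ x : Site 2 L, ∑ σ : Fin 2,
    (((A (x, 0) : Circle) : ℂ) *
      (star ψ ⬝ᵥ ((creation (orb (FermionTorus.ofTorusSite (Site.shift x 0)) σ) *
        annihilation (orb (FermionTorus.ofTorusSite x) σ)) *ᵥ ψ))).re with hKdef
  have hKle : |K| ≤ (L : ℝ) ^ 2 := abs_sum_re_coe_mul_hop_le_sq hL h1 A
  have hp : magneticTwistEnergy L A U δ θ ≤
      (star ψ ⬝ᵥ (magneticHubbardTorus L (A * uniformTwistConfig L θ) 1 U *ᵥ ψ)).re :=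
    minEnergyOn_le_rayleigh_of_mem (magneticHubbardTorus_isHermitian _ 1 U) _ hψ h1
  have hm : magneticTwistEnergy L A U δ (-θ) ≤
      (star ψ ⬝ᵥ (magneticHubbardTorus L (A * uniformTwistConfig L (-θ)) 1 U *ᵥ ψ)).re :=
    minEnergyOn_le_rayleigh_of_mem (magneticHubbardTorus_isHermitian _ 1 U) _ hψ h1
  have hid := re_rayleigh_twist_add_twist_neg A U θ ψ
  have hc : 0 ≤ 1 - Real.cos (θ / L) := sub_nonneg.2 (Real.cos_le_one _)
  have hcos : 2 * (1 - Real.cos (θ / L)) ≤ (θ / L) ^ 2 := by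
    have h := Real.one_sub_sq_div_two_le_cos (x := θ / L)
    nlinarith
  have hstep : 4 * (1 - Real.cos (θ / L)) * K ≤ 2 * θ ^ 2 :=
    calc 4 * (1 - Real.cos (θ / L)) * K ≤ 4 * (1 - Real.cos (θ / L)) * |K| := by
          have := le_abs_self K; nlinarith
      _ = 2 * (2 * (1 - Real.cos (θ / L))) * |K| := by ring
      _ ≤ 2 * (θ / L) ^ 2 * |K| := by gcongr
      _ ≤ 2 * (θ / L) ^ 2 * (L : ℝ) ^ 2 := by gcongr
      _ = 2 * θ ^ 2 := by field_simp
  linarith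

/-- **For `L ≥ 2` every flux stiffness of the Hubbard torus in an orbital field is at most `1`** (tree units):
`ρ θ² ≤ E_A(θ) − E_A(0)` for `|θ| ≤ θ₀` forces `ρ ≤ 1`, for every lattice `U(1)` gauge field `A`, every `U` and
filling. With the Nelson–Kosterlitz dictionary of the cell (a hypothesis there, not here) this is the
field-robust `k_BT_KT ≤ (π/4)·t` per plane. [cite: Bohm1949] [cite: ScalapinoWhiteZhang1993, §II] -/
theorem magneticFluxStiffness_le_one (hL : 2 ≤ L) (A : GaugeConfig 2 L Circle) (U δ ρ θ₀ : ℝ) (hθ₀ : 0 < θ₀)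
    (hst : ∀ θ : ℝ, |θ| ≤ θ₀ →
      ρ * θ ^ 2 ≤ magneticTwistEnergy L A U δ θ - magneticTwistEnergy L A U δ 0) :
    ρ ≤ 1 := by
  have hp := hst θ₀ (by rw [abs_of_pos hθ₀])
  have hm := hst (-θ₀) (by rw [abs_neg, abs_of_pos hθ₀])
  have hb := magneticTwistEnergy_add_neg_le_of_two_le hL A U δ θ₀
  have hsq : 0 < θ₀ ^ 2 := by positivity
  rw [neg_sq] at hm
  nlinarith

end Literature.MathematicalPhysics.QuantumLattice
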